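import Mathlib.Analysis.Calculus.DerivativeTest
import Mathlib.Analysis.SpecialFunctions.Trigonometric.Bounds
import Mathlib.Analysis.SpecialFunctions.Pow.Deriv
import Mathlib.Analysis.SpecialFunctions.Pow.Continuity
import Mathlib.Analysis.Complex.Trigonometric
import Mathlib.Topology.Order.Compact
import Mathlib.Analysis.Real.Pi.Bounds
import HarnessLib

/-!
# The one-arm exponent: LSW's maximum-principle comparison (proof of Thm. 1.2, (2.17))

Topic `Literature/Probability/Percolation`; family `crit-perc`. This file continues the
bottom-up discharge of the named fact `Literature.Probability.Percolation.oneArm_exponent` (`ArmExponents.lean`;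
Lawler–Schramm–Werner, *One-arm exponent for critical 2D percolation*, Electron. J. Probab. 7
(2002), paper no. 2, Thm. 1.1). `OneArmScalingLimit.lean` reduced it to two continuum facts, the
existence of the scaling limit and **LSW Theorem 1.2** (the exponent `5/48` for the scaling
limit). The printed proof of Theorem 1.2 (LSW §2) has a probabilistic half — Smirnov's
Theorem 2.1, radial `SLE₆` and Itô's formula giving the PDE (2.4) for
`h(θ, t) = P[𝔯(θ) ≤ e^{-t}]` (Lemma 2.2), the Dirichlet condition (2.3) and the Neumann
condition (2.12) (Lemma 2.3) — and a purely deterministic half, the paragraph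
"**Proof of Theorem 1.2**" (pp. 7–8): a maximum-principle argument showing that *any* function
`h̃` with these properties is comparable, for `t ≥ 1`, with the explicit solution
`H(θ, t) = sin(θ/4)^q e^{-λt}`, `q = (κ-4)/κ`, `λ = (κ²-16)/(32κ)` (so `λ(6) = 5/48`):

> (2.17) `∀ t ≥ 1, ∀ θ ∈ [0, 2π], c H(θ, t) ≤ h̃(θ, t) ≤ c' H(θ, t)`.

This file PROVES the deterministic half, for every `κ > 4` as in the paper ("The reason that we
keep `κ` as a parameter is that some of the work done below will also apply to the proof of
Theorem 1.3", p. 4), following the printed argument line by line: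

* `lswOp κ θ F_θθ F_θ F_t = (κ/2) F_θθ + cot(θ/2) F_θ - F_t` is the operator `Λ` of (2.4);
  `lswLambda κ = (κ² - 16)/(32κ)` is (1.1); `lswQ κ = (κ - 4)/κ` and
  `lswH κ θ t = sin(θ/4)^q e^{-λt}` are `q` and `H` of p. 7; `lswOp_lswH : Λ H = 0`.
* `lsw_maxPrinciple` — the claim of p. 7: "Suppose that a function `G` is defined and
  continuous on `S*`, …, `G ≥ 0` on `t = 0`, `G = 0` on `θ = 0`, `∂_θ G = 0` on `θ = 2π` and
  `Λ(G) = 0` in `S`. Then `G ≥ 0`", in the generality in which the paper USES it (p. 8: on a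
  rectangle `[0, b] × [T₀, T₁]`, `b ≤ 2π`, with `Λ G ≤ 0`, `G ≥ 0` on the bottom and left sides,
  and on the right side either `G ≥ 0` (the application "with `S` replaced by `(0, π) × (0, 1)`")
  or a one-sided `θ`-derivative `≥ 0` (the application "in the range `[0, 2π] × [1, ∞)`")).
  The proof is the printed one: perturb to `F = G + ε θ^{q/2} + ε`, for which `Λ F < 0`
  (`lswOp_rpow_neg`, "A computation using the explicit value of `q`"), take a point of
  `{F ≤ 0}` with minimal `t` (compactness), observe it is interior, and contradict `Λ F < 0` by
  `∂_θ F = 0`, `∂²_θ F ≥ 0`, `∂_t F ≤ 0` there (`lsw_maxPrinciple_strict`).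
* `LawlerSchrammWerner2002_comparison` — (2.17) itself: for `κ > 4` and any `g` continuous on
  `[0, 2π] × [0, ∞)`, `C²` in `θ` and `C¹` in `t` on `S = (0, 2π) × (0, ∞)` with `Λ g = 0`
  there, `g(0, t) = 0` (`t > 0`), `∂_θ g(2π, t) = 0` one-sidedly (`t > 0`), `0 ≤ g ≤ 1`, and
  `g > 0` on `(0, 2π] × [0, ∞)`, there are `c, c' > 0` with `c H ≤ g ≤ c' H` on
  `[0, 2π] × [1, ∞)`. The proof is the printed one: `Λ(2 - 2t - θ²) < 0` on `(0, π)`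
  (`lswOp_lswAux_neg`), the functions `F₁ = c₁ H - g + 2 - 2t - θ²`, `F₂ = c₂ g - H + 2 - 2t - θ²`
  on `[0, π] × [0, 1]`, extension of the resulting inequalities at `t = 1` to `[0, 2π]` by
  enlarging the constants, and a final application of the maximum principle on
  `[0, 2π] × [1, ∞)` with the Neumann side condition.

On the hypotheses of `LawlerSchrammWerner2002_comparison`: the paper lists (p. 7) "`Λ h̃ = 0` in
`S`, the Neumann boundary condition (2.12), the Dirichlet condition `h̃(0, t) = 0` for `t > 0`,
`0 ≤ h̃ ≤ 1` and `h̃(θ, 0) > 0` for `θ ∈ (0, 2π]`", plus continuity on `S*` in the claim; the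
choice of `c₂` on p. 8 ("chosen so that `F₂ > 0` on `{π} × [0, 1]`", and "changing the
constants … for all `θ ∈ [0, 2π]`") also uses `h̃(π, t) > 0` for `t ∈ [0, 1]` and `h̃(θ, 1) > 0`
for `θ ∈ [π, 2π]`, all instances of the positivity of the probability
`h̃ = ∫₀¹ P[𝔯(θ) ≤ e^{-t-s}] ds`; we assume positivity on `(0, 2π] × [0, ∞)` and continuity on
the closed domain (for `h̃` both follow from (2.2)–(2.3), see the sequel file). Smoothness is
assumed only in the form used: first and second `θ`-derivatives and a first `t`-derivative,
given as functions with `HasDerivAt`.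

## Contents

* `lswLambda`, `lswQ`, `lswH`, `lswHθ`, `lswHθθ`, `lswOp` and their elementary properties
  (`lswLambda_six : lswLambda 6 = 5/48`, positivity, `Λ H = 0`, `∂_θ H (2π, t) = 0`).
* `mul_cot_half_lt_two : θ cot(θ/2) < 2` on `(0, 2π)`; `mul_cot_half_pos` on `(0, π)`.
* `lswOp_rpow_neg : Λ(θ^{q/2}) < 0` on `(0, 2π)`;
  `lswOp_lswAux_neg : Λ(2 - 2t - θ²) < 0` on `(0, π)`.
* `nonneg_of_isLocalMin_of_hasDerivAt` — second-derivative test at an interior minimum.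
* `lsw_maxPrinciple_strict`, `lsw_maxPrinciple`, `LawlerSchrammWerner2002_comparison`.

Mathlib: `Real.cot`, `Real.rpow` calculus (`Real.hasDerivAt_rpow_const`), `Real.lt_tan`,
the derivative tests of `Mathlib.Analysis.Calculus.DerivativeTest`
(`isLocalMax_of_deriv_deriv_neg`, `IsLocalMin.deriv_eq_zero`), `IsCompact.exists_isMinOn`.
No PDE theory is used or built.

## References

* G. F. Lawler, O. Schramm, W. Werner, *One-arm exponent for critical 2D percolation*, Electron.
  J. Probab. 7 (2002), no. 2 — (1.1) (p. 2), Lemma 2.2 and (2.4) (p. 4), proof of Theorem 1.2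
  and (2.17) (pp. 7–8) [LawlerSchrammWernerEJP2002].
-/

noncomputable section

open Real Filter Topology Set

namespace Literature.Probability.Percolation

/-! ### The operator `Λ`, the exponents `λ`, `q` and the comparison function `H` -/

/-- LSW's exponent `λ(κ) = (κ² - 16) / (32 κ)` ((1.1), p. 2); `λ(6) = 5/48`.
[cite: LawlerSchrammWernerEJP2002, (1.1) (p. 2)] -/
def lswLambda (κ : ℝ) : ℝ := (κ ^ 2 - 16) / (32 * κ)

/-- LSW's exponent `q = (κ - 4) / κ` of the comparison function `H` (p. 7); `q(6) = 1/3`.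
[cite: LawlerSchrammWernerEJP2002, proof of Thm. 1.2 (p. 7)] -/
def lswQ (κ : ℝ) : ℝ := (κ - 4) / κ

/-- LSW's comparison function `H(θ, t) = sin(θ/4)^q e^{-λ t}` (p. 7), an explicit solution of
`Λ H = 0` with `H(0, t) = 0` and `∂_θ H(2π, t) = 0`.
[cite: LawlerSchrammWernerEJP2002, proof of Thm. 1.2 (p. 7)] -/
def lswH (κ θ t : ℝ) : ℝ := Real.sin (θ / 4) ^ lswQ κ * Real.exp (-(lswLambda κ * t))

/-- `∂_θ H (θ, t) = (q/4) sin(θ/4)^{q-1} cos(θ/4) e^{-λt}` (elementary calculus). [folklore] -/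
def lswHθ (κ θ t : ℝ) : ℝ :=
  lswQ κ / 4 * Real.sin (θ / 4) ^ (lswQ κ - 1) * Real.cos (θ / 4) * Real.exp (-(lswLambda κ * t))

/-- `∂²_θ H (θ, t) = (q/16) ((q-1) sin(θ/4)^{q-2} cos(θ/4)² - sin(θ/4)^q) e^{-λt}` (elementary
calculus). [folklore] -/
def lswHθθ (κ θ t : ℝ) : ℝ :=
  lswQ κ / 16 * ((lswQ κ - 1) * Real.sin (θ / 4) ^ (lswQ κ - 2) * Real.cos (θ / 4) ^ 2 -
    Real.sin (θ / 4) ^ lswQ κ) * Real.exp (-(lswLambda κ * t))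

/-- LSW's differential operator `Λ` ((2.4), p. 4) evaluated at a point `θ` on a function whose
second `θ`-derivative, first `θ`-derivative and `t`-derivative there are `Fθθ`, `Fθ`, `Ft`:
`Λ F = (κ/2) ∂²_θ F + cot(θ/2) ∂_θ F - ∂_t F`.
[cite: LawlerSchrammWernerEJP2002, Lemma 2.2, (2.4) (p. 4)] -/
def lswOp (κ θ Fθθ Fθ Ft : ℝ) : ℝ := κ / 2 * Fθθ + Real.cot (θ / 2) * Fθ - Ft

/-- `λ(6) = 5/48`, the one-arm exponent (LSW p. 2). [cite: LawlerSchrammWernerEJP2002, (1.1)] -/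
theorem lswLambda_six : lswLambda 6 = 5 / 48 := by norm_num [lswLambda]

/-- `q(6) = 1/3`. [folklore] -/
theorem lswQ_six : lswQ 6 = 1 / 3 := by norm_num [lswQ]

/-- `λ(κ) > 0` for `κ > 4`. [folklore] -/
theorem lswLambda_pos {κ : ℝ} (hκ : 4 < κ) : 0 < lswLambda κ := by
  unfold lswLambda
  apply div_pos _ (by linarith)
  nlinarith

/-- `q(κ) ∈ (0, 1)` for `κ > 4`: positivity. [folklore] -/
theorem lswQ_pos {κ : ℝ} (hκ : 4 < κ) : 0 < lswQ κ := by
  unfold lswQ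
  exact div_pos (by linarith) (by linarith)

/-- `q(κ) < 1` for `κ > 4` (indeed for `κ > 0`). [folklore] -/
theorem lswQ_lt_one {κ : ℝ} (hκ : 4 < κ) : lswQ κ < 1 := by
  unfold lswQ
  rw [div_lt_one (by linarith)]
  linarith

/-- `Λ` is linear in the derivative data: additivity. [folklore] -/
theorem lswOp_add (κ θ a b c a' b' c' : ℝ) :
    lswOp κ θ (a + a') (b + b') (c + c') = lswOp κ θ a b c + lswOp κ θ a' b' c' := by
  unfold lswOp; ring

/-- `Λ` is linear in the derivative data: homogeneity. [folklore] -/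
theorem lswOp_smul (κ θ r a b c : ℝ) :
    lswOp κ θ (r * a) (r * b) (r * c) = r * lswOp κ θ a b c := by
  unfold lswOp; ring

/-- `Λ` is linear in the derivative data: negation. [folklore] -/
theorem lswOp_neg (κ θ a b c : ℝ) :
    lswOp κ θ (-a) (-b) (-c) = -lswOp κ θ a b c := by
  unfold lswOp; ring

/-! ### Trigonometric inequalities for the drift `cot(θ/2)` -/

/-- `θ cot(θ/2) < 2` for `θ ∈ (0, 2π)` (equivalently `x cos x < sin x` on `(0, π)`; from
`x < tan x` on `(0, π/2)` and `cos ≤ 0` on `[π/2, π)`). [folklore] -/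
theorem mul_cot_half_lt_two {θ : ℝ} (h0 : 0 < θ) (h1 : θ < 2 * π) :
    θ * Real.cot (θ / 2) < 2 := by
  obtain ⟨x, rfl⟩ : ∃ x, θ = 2 * x := ⟨θ / 2, by ring⟩
  have hx0 : 0 < x := by linarith
  have hxπ : x < π := by linarith
  have hsin : 0 < Real.sin x := Real.sin_pos_of_pos_of_lt_pi hx0 hxπ
  rw [show 2 * x / 2 = x by ring, Real.cot_eq_cos_div_sin, mul_div_assoc', div_lt_iff₀ hsin]
  rcases lt_trichotomy x (π / 2) with hlt | heq | hgt
  · have htan := Real.lt_tan hx0 hlt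
    have hcos : 0 < Real.cos x := Real.cos_pos_of_mem_Ioo ⟨by linarith, hlt⟩
    rw [Real.tan_eq_sin_div_cos, lt_div_iff₀ hcos] at htan
    nlinarith
  · rw [heq, Real.cos_pi_div_two, Real.sin_pi_div_two]; norm_num
  · have hcos : Real.cos x < 0 := Real.cos_neg_of_pi_div_two_lt_of_lt hgt (by linarith)
    nlinarith

/-- `θ cot(θ/2) > 0` for `θ ∈ (0, π)`. [folklore] -/
theorem mul_cot_half_pos {θ : ℝ} (h0 : 0 < θ) (h1 : θ < π) : 0 < θ * Real.cot (θ / 2) := by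
  have hsin : 0 < Real.sin (θ / 2) := Real.sin_pos_of_pos_of_lt_pi (by linarith) (by linarith)
  have hcos : 0 < Real.cos (θ / 2) := Real.cos_pos_of_mem_Ioo ⟨by linarith, by linarith⟩
  rw [Real.cot_eq_cos_div_sin]
  positivity

/-! ### `Λ` of the barrier functions and of `H` -/

/-- "A computation using the explicit value of `q` shows that `Λ(θ^{q/2}) < 0` in `S`" (LSW p. 7):
for `κ > 4`, `p = q/2` and `θ ∈ (0, 2π)`,
`Λ(θ^p) = p θ^{p-2} ((κ/2)(p-1) + θ cot(θ/2)) < 0`, since `(κ/2)(p - 1) = -(κ+4)/4` and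
`θ cot(θ/2) < 2`. [cite: LawlerSchrammWernerEJP2002, proof of Thm. 1.2 (p. 7)] -/
theorem lswOp_rpow_neg {κ θ : ℝ} (hκ : 4 < κ) (h0 : 0 < θ) (h1 : θ < 2 * π) :
    lswOp κ θ (lswQ κ / 2 * ((lswQ κ / 2 - 1) * θ ^ (lswQ κ / 2 - 2)))
      (lswQ κ / 2 * θ ^ (lswQ κ / 2 - 1)) 0 < 0 := by
  set p := lswQ κ / 2 with hp
  have hp0 : 0 < p := by rw [hp]; exact half_pos (lswQ_pos hκ)
  have hκ0 : κ ≠ 0 := by linarith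
  have hA : 0 < θ ^ (p - 2) := Real.rpow_pos_of_pos h0 _
  have hpow : θ ^ (p - 1) = θ ^ (p - 2) * θ := by
    rw [show p - 1 = p - 2 + 1 by ring, Real.rpow_add h0, Real.rpow_one]
  have hcoef : κ / 2 * (p - 1) = -(κ + 4) / 4 := by
    rw [hp, lswQ]; field_simp; ring
  have hcot := mul_cot_half_lt_two h0 h1
  have key : lswOp κ θ (p * ((p - 1) * θ ^ (p - 2))) (p * θ ^ (p - 1)) 0 =
      p * θ ^ (p - 2) * (κ / 2 * (p - 1) + θ * Real.cot (θ / 2)) := by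
    unfold lswOp; rw [hpow]; ring
  rw [key, hcoef]
  apply mul_neg_of_pos_of_neg (mul_pos hp0 hA)
  nlinarith

/-- `Λ(2 - 2t - θ²) = 2 - κ - 2 θ cot(θ/2) < 0` for `θ ∈ (0, π)` and `κ ≥ 2` (LSW p. 8:
"note that `Λ(2 - 2t - θ²) < 0` for `θ ∈ (0, π)`"); the derivative data of `2 - 2t - θ²` are
`∂²_θ = -2`, `∂_θ = -2θ`, `∂_t = -2`.
[cite: LawlerSchrammWernerEJP2002, proof of Thm. 1.2 (p. 8)] -/
theorem lswOp_lswAux_neg {κ θ : ℝ} (hκ : 2 ≤ κ) (h0 : 0 < θ) (h1 : θ < π) :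
    lswOp κ θ (-2) (-2 * θ) (-2) < 0 := by
  have := mul_cot_half_pos h0 h1
  unfold lswOp
  nlinarith

/-- `sin(θ/4) > 0` for `θ ∈ (0, 2π]` (indeed on `(0, 4π)`). [folklore] -/
theorem sin_quarter_pos {θ : ℝ} (h0 : 0 < θ) (h1 : θ ≤ 2 * π) : 0 < Real.sin (θ / 4) :=
  Real.sin_pos_of_pos_of_lt_pi (by linarith) (by linarith [Real.pi_pos])

/-- `cos(θ/4) > 0` for `θ ∈ [0, 2π)`. [folklore] -/
theorem cos_quarter_pos {θ : ℝ} (h0 : 0 ≤ θ) (h1 : θ < 2 * π) : 0 < Real.cos (θ / 4) :=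
  Real.cos_pos_of_mem_Ioo ⟨by linarith [Real.pi_pos], by linarith⟩

/-- `θ ↦ H(θ, t)` has derivative `lswHθ` wherever `sin(θ/4) ≠ 0` (chain rule). [folklore] -/
theorem hasDerivAt_lswH_theta {κ θ : ℝ} (t : ℝ) (hs : Real.sin (θ / 4) ≠ 0) :
    HasDerivAt (fun x => lswH κ x t) (lswHθ κ θ t) θ := by
  have h1 : HasDerivAt (fun x : ℝ => x / 4) (1 / 4) θ := by
    simpa using (hasDerivAt_id θ).div_const 4
  have h2 : HasDerivAt (fun x : ℝ => Real.sin (x / 4)) (Real.cos (θ / 4) * (1 / 4)) θ := h1.sin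
  have h3 := h2.rpow_const (p := lswQ κ) (Or.inl hs)
  have h4 := h3.mul_const (Real.exp (-(lswLambda κ * t)))
  exact h4.congr_deriv (by unfold lswHθ; ring)

/-- `θ ↦ ∂_θ H(θ, t)` has derivative `lswHθθ` wherever `sin(θ/4) ≠ 0`. [folklore] -/
theorem hasDerivAt_lswHθ_theta {κ θ : ℝ} (t : ℝ) (hs : Real.sin (θ / 4) ≠ 0) :
    HasDerivAt (fun x => lswHθ κ x t) (lswHθθ κ θ t) θ := by
  have h1 : HasDerivAt (fun x : ℝ => x / 4) (1 / 4) θ := by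
    simpa using (hasDerivAt_id θ).div_const 4
  have h2 : HasDerivAt (fun x : ℝ => Real.sin (x / 4)) (Real.cos (θ / 4) * (1 / 4)) θ := h1.sin
  have h3 : HasDerivAt (fun x : ℝ => Real.cos (x / 4)) (-Real.sin (θ / 4) * (1 / 4)) θ := h1.cos
  have h4 := h2.rpow_const (p := lswQ κ - 1) (Or.inl hs)
  have h5 := ((h4.const_mul (lswQ κ / 4)).mul h3).mul_const (Real.exp (-(lswLambda κ * t)))
  have e1 : Real.sin (θ / 4) ^ (lswQ κ - 1) = Real.sin (θ / 4) ^ lswQ κ / Real.sin (θ / 4) :=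
    Real.rpow_sub_one hs _
  have e2 : Real.sin (θ / 4) ^ (lswQ κ - 1 - 1) = Real.sin (θ / 4) ^ (lswQ κ - 2) := by
    rw [show lswQ κ - 1 - 1 = lswQ κ - 2 by ring]
  refine h5.congr_deriv ?_
  unfold lswHθθ
  rw [e2, e1]
  field_simp
  ring

/-- `t ↦ H(θ, t)` has derivative `-λ H(θ, t)`. [folklore] -/
theorem hasDerivAt_lswH_t (κ θ t : ℝ) :
    HasDerivAt (fun s => lswH κ θ s) (-lswLambda κ * lswH κ θ t) t := by
  have h1 : HasDerivAt (fun s : ℝ => -(lswLambda κ * s)) (-lswLambda κ) t :=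
    (((hasDerivAt_id t).const_mul (lswLambda κ)).neg).congr_deriv (by simp)
  have h2 := h1.exp.const_mul (Real.sin (θ / 4) ^ lswQ κ)
  exact h2.congr_deriv (by unfold lswH; ring)

/-- **`Λ H = 0`** on `(0, 2π)` (LSW p. 7: "Note that `H` also has all these properties"): with
`s = sin(θ/4)`, `c = cos(θ/4)`, `cot(θ/2) = (c² - s²)/(2sc)`, the coefficient of `s^{q-2}` in
`e^{λt} Λ H` is `q (κ(q-1) + 4)/32 = 0` and that of `s^q` is `λ - (κ² - 16)/(32κ) = 0`.
[cite: LawlerSchrammWernerEJP2002, proof of Thm. 1.2 (p. 7)] -/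
theorem lswOp_lswH {κ θ : ℝ} (hκ : 4 < κ) (h0 : 0 < θ) (h1 : θ < 2 * π) (t : ℝ) :
    lswOp κ θ (lswHθθ κ θ t) (lswHθ κ θ t) (-lswLambda κ * lswH κ θ t) = 0 := by
  have hs : 0 < Real.sin (θ / 4) := sin_quarter_pos h0 h1.le
  have hc : 0 < Real.cos (θ / 4) := cos_quarter_pos h0.le h1
  have hκ0 : κ ≠ 0 := by linarith
  have hcot : Real.cot (θ / 2) =
      (1 - 2 * Real.sin (θ / 4) ^ 2) / (2 * Real.sin (θ / 4) * Real.cos (θ / 4)) := by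
    rw [Real.cot_eq_cos_div_sin, show θ / 2 = 2 * (θ / 4) by ring, Real.cos_two_mul,
      Real.sin_two_mul, Real.cos_sq']
    ring_nf
  have e1 : Real.sin (θ / 4) ^ (lswQ κ - 1) = Real.sin (θ / 4) ^ lswQ κ / Real.sin (θ / 4) :=
    Real.rpow_sub_one hs.ne' _
  have e2 : Real.sin (θ / 4) ^ (lswQ κ - 2) = Real.sin (θ / 4) ^ lswQ κ / Real.sin (θ / 4) ^ 2 := by
    rw [Real.rpow_sub hs, Real.rpow_two]
  have hc2 : Real.cos (θ / 4) ^ 2 = 1 - Real.sin (θ / 4) ^ 2 := Real.cos_sq' _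
  unfold lswOp lswHθθ lswHθ lswH
  rw [hcot, e1, e2, hc2]
  unfold lswQ lswLambda
  field_simp
  ring

/-- `∂_θ H (2π, t) = 0`: the Neumann condition of `H` at `θ = 2π` (`cos(π/2) = 0`).
[cite: LawlerSchrammWernerEJP2002, proof of Thm. 1.2 (p. 7)] -/
theorem lswHθ_two_pi (κ t : ℝ) : lswHθ κ (2 * π) t = 0 := by
  unfold lswHθ
  rw [show 2 * π / 4 = π / 2 by ring, Real.cos_pi_div_two]
  ring

/-- `H(0, t) = 0` (`q > 0`). [folklore] -/
theorem lswH_zero_left {κ : ℝ} (hκ : 4 < κ) (t : ℝ) : lswH κ 0 t = 0 := by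
  unfold lswH
  rw [zero_div, Real.sin_zero, Real.zero_rpow (lswQ_pos hκ).ne']
  ring

/-- `0 ≤ H(θ, t)` for `θ ∈ [0, 2π]`. [folklore] -/
theorem lswH_nonneg {κ θ : ℝ} (h0 : 0 ≤ θ) (h1 : θ ≤ 2 * π) (t : ℝ) : 0 ≤ lswH κ θ t := by
  unfold lswH
  have : 0 ≤ Real.sin (θ / 4) :=
    Real.sin_nonneg_of_nonneg_of_le_pi (by linarith) (by linarith [Real.pi_pos])
  exact mul_nonneg (Real.rpow_nonneg this _) (Real.exp_pos _).le

/-- `H(θ, t) ≤ 1` for `θ ∈ [0, 2π]`, `t ≥ 0` and `κ > 4`. [folklore] -/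
theorem lswH_le_one {κ θ t : ℝ} (hκ : 4 < κ) (h0 : 0 ≤ θ) (h1 : θ ≤ 2 * π) (ht : 0 ≤ t) :
    lswH κ θ t ≤ 1 := by
  unfold lswH
  have hs0 : 0 ≤ Real.sin (θ / 4) :=
    Real.sin_nonneg_of_nonneg_of_le_pi (by linarith) (by linarith [Real.pi_pos])
  have hs1 : Real.sin (θ / 4) ^ lswQ κ ≤ 1 :=
    Real.rpow_le_one hs0 (Real.sin_le_one _) (lswQ_pos hκ).le
  have he : Real.exp (-(lswLambda κ * t)) ≤ 1 := by
    rw [Real.exp_le_one_iff, neg_nonpos]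
    exact mul_nonneg (lswLambda_pos hκ).le ht
  calc Real.sin (θ / 4) ^ lswQ κ * Real.exp (-(lswLambda κ * t))
      ≤ 1 * 1 := mul_le_mul hs1 he (Real.exp_pos _).le zero_le_one
    _ = 1 := one_mul _

/-- Monotonicity of `H` in `θ` on `[0, 2π]` used to bound it below: for `a ≤ θ ≤ 2π` with
`0 ≤ a`, `sin(a/4)^q ≤ sin(θ/4)^q`. [folklore] -/
theorem sin_quarter_rpow_mono {κ a θ : ℝ} (hκ : 4 < κ) (ha : 0 ≤ a) (haθ : a ≤ θ)
    (h1 : θ ≤ 2 * π) : Real.sin (a / 4) ^ lswQ κ ≤ Real.sin (θ / 4) ^ lswQ κ := by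
  have hsa : 0 ≤ Real.sin (a / 4) :=
    Real.sin_nonneg_of_nonneg_of_le_pi (by linarith) (by linarith [Real.pi_pos])
  refine Real.rpow_le_rpow hsa ?_ (lswQ_pos hκ).le
  exact Real.sin_le_sin_of_le_of_le_pi_div_two (by linarith [Real.pi_pos]) (by linarith)
    (by linarith)

/-- Lower bound for `H` on `[a, 2π] × [0, T]`: `H(θ, t) ≥ sin(a/4)^q e^{-λ T}`. [folklore] -/
theorem lswH_ge {κ a θ t T : ℝ} (hκ : 4 < κ) (ha : 0 ≤ a) (haθ : a ≤ θ) (h1 : θ ≤ 2 * π)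
    (htT : t ≤ T) : Real.sin (a / 4) ^ lswQ κ * Real.exp (-(lswLambda κ * T)) ≤ lswH κ θ t := by
  unfold lswH
  have hsa : 0 ≤ Real.sin (a / 4) :=
    Real.sin_nonneg_of_nonneg_of_le_pi (by linarith) (by linarith [Real.pi_pos])
  refine mul_le_mul (sin_quarter_rpow_mono hκ ha haθ h1) ?_ (Real.exp_pos _).le
    (Real.rpow_nonneg (hsa.trans (Real.sin_le_sin_of_le_of_le_pi_div_two
      (by linarith [Real.pi_pos]) (by linarith) (by linarith))) _)
  exact Real.exp_le_exp.2 (by nlinarith [lswLambda_pos hκ])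

/-- `H` is jointly continuous (`q > 0`). [folklore] -/
theorem continuous_lswH {κ : ℝ} (hκ : 4 < κ) : Continuous fun p : ℝ × ℝ => lswH κ p.1 p.2 := by
  unfold lswH
  refine Continuous.mul ?_ (by fun_prop)
  exact (Real.continuous_sin.comp (continuous_fst.div_const 4)).rpow_const
    fun _ => Or.inr (lswQ_pos hκ).le

/-! ### The second-derivative test at an interior minimum -/

/-- If `f` has a local minimum at `x₀`, is differentiable near `x₀` with derivative `f'`, and
`f'` is differentiable at `x₀` with derivative `d`, then `d ≥ 0` (from Mathlib's
second-derivative test `isLocalMax_of_deriv_deriv_neg`: `d < 0` would make `x₀` also a strict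
local maximum, so `f` would be locally constant and `d = 0`). [folklore] -/
theorem nonneg_of_isLocalMin_of_hasDerivAt {f f' : ℝ → ℝ} {x₀ d : ℝ} (hmin : IsLocalMin f x₀)
    (hf : ∀ᶠ x in 𝓝 x₀, HasDerivAt f (f' x) x) (hf' : HasDerivAt f' d x₀) : 0 ≤ d := by
  by_contra hd
  push Not at hd
  have hderiv : deriv f =ᶠ[𝓝 x₀] f' := hf.mono fun x hx => hx.deriv
  have h1 : deriv f x₀ = 0 := hmin.deriv_eq_zero
  have h2 : deriv (deriv f) x₀ = d := by rw [hderiv.deriv_eq]; exact hf'.deriv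
  have hcont : ContinuousAt f x₀ := hf.self_of_nhds.continuousAt
  have hmax : IsLocalMax f x₀ := isLocalMax_of_deriv_deriv_neg (by rwa [h2]) h1 hcont
  have hconst : f =ᶠ[𝓝 x₀] fun _ => f x₀ :=
    (hmin.and hmax).mono fun x hx => le_antisymm hx.2 hx.1
  have hderiv0 : deriv f =ᶠ[𝓝 x₀] fun _ => (0 : ℝ) :=
    hconst.eventuallyEq_nhds.mono fun x hx => by rw [hx.deriv_eq]; simp
  have h3 : deriv (deriv f) x₀ = 0 := by rw [hderiv0.deriv_eq]; simp
  linarith [h2.symm.trans h3]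

/-! ### The maximum principle (LSW p. 7) -/

/-- **Strict maximum principle for `Λ` on a rectangle.** Let `F` be continuous on
`[0, b] × [T₀, T₁]`, with first and second `θ`-derivatives `Fθ`, `Fθθ` and `t`-derivative `Ft`
at every point of `(0, b) × (T₀, T₁]` satisfying `Λ F < 0` there; suppose `F > 0` on the
bottom side `t = T₀` and on the left side `θ = 0`, and that on the right side `θ = b`,
whenever `F(b, t) ≤ 0` some interior `θ` has `F(θ, t) < 0` (true if `F(b, t) > 0`, or if
`F(·, t)` has a positive left derivative at `b`). Then `F > 0` on the whole rectangle. This is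
the core of the argument on p. 7 of LSW: a point of `{F ≤ 0}` with minimal `t` is interior and
has `∂_θ F = 0`, `∂²_θ F ≥ 0`, `∂_t F ≤ 0`, contradicting `Λ F < 0`.
[cite: LawlerSchrammWernerEJP2002, proof of Thm. 1.2 (p. 7)] -/
theorem lsw_maxPrinciple_strict {κ b T₀ T₁ : ℝ} (hκ : 0 < κ)
    {F Fθ Fθθ Ft : ℝ → ℝ → ℝ}
    (hcont : ContinuousOn (fun p : ℝ × ℝ => F p.1 p.2) (Icc 0 b ×ˢ Icc T₀ T₁))
    (hderθ : ∀ θ ∈ Ioo 0 b, ∀ t ∈ Ioc T₀ T₁, HasDerivAt (fun x => F x t) (Fθ θ t) θ)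
    (hderθθ : ∀ θ ∈ Ioo 0 b, ∀ t ∈ Ioc T₀ T₁, HasDerivAt (fun x => Fθ x t) (Fθθ θ t) θ)
    (hdert : ∀ θ ∈ Ioo 0 b, ∀ t ∈ Ioc T₀ T₁, HasDerivAt (fun s => F θ s) (Ft θ t) t)
    (hop : ∀ θ ∈ Ioo 0 b, ∀ t ∈ Ioc T₀ T₁, lswOp κ θ (Fθθ θ t) (Fθ θ t) (Ft θ t) < 0)
    (hbot : ∀ θ ∈ Icc 0 b, 0 < F θ T₀)
    (hleft : ∀ t ∈ Icc T₀ T₁, 0 < F 0 t)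
    (hright : ∀ t ∈ Ioc T₀ T₁, F b t ≤ 0 → ∃ θ ∈ Ioo 0 b, F θ t < 0) :
    ∀ θ ∈ Icc 0 b, ∀ t ∈ Icc T₀ T₁, 0 < F θ t := by
  by_contra hneg
  push Not at hneg
  obtain ⟨θ₁, hθ₁, t₁, ht₁, hF₁⟩ := hneg
  set K : Set (ℝ × ℝ) := Icc 0 b ×ˢ Icc T₀ T₁ with hK
  set Z : Set (ℝ × ℝ) := K ∩ (fun p : ℝ × ℝ => F p.1 p.2) ⁻¹' Iic 0 with hZ
  have hKc : IsCompact K := isCompact_Icc.prod isCompact_Icc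
  have hZc : IsClosed Z :=
    hcont.preimage_isClosed_of_isClosed (isClosed_Icc.prod isClosed_Icc) isClosed_Iic
  have hZcpt : IsCompact Z := hKc.of_isClosed_subset hZc inter_subset_left
  have hZne : Z.Nonempty := ⟨(θ₁, t₁), ⟨hθ₁, ht₁⟩, hF₁⟩
  obtain ⟨p₀, hp₀Z, hmin⟩ := hZcpt.exists_isMinOn hZne continuous_snd.continuousOn
  obtain ⟨⟨hθ₀, ht₀⟩, hF₀⟩ := hp₀Z
  obtain ⟨θ₀, t₀⟩ := p₀
  simp only [mem_preimage, mem_Iic] at hF₀ hθ₀ ht₀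
  -- minimality of `t₀`
  have hmin' : ∀ θ ∈ Icc 0 b, ∀ t ∈ Icc T₀ T₁, F θ t ≤ 0 → t₀ ≤ t := by
    intro θ hθ t ht hF
    exact hmin (a := (θ, t)) ⟨⟨hθ, ht⟩, hF⟩
  have hpos_lt : ∀ θ ∈ Icc 0 b, ∀ t ∈ Icc T₀ T₁, t < t₀ → 0 < F θ t :=
    fun θ hθ t ht hlt => lt_of_not_ge fun hF => (hmin' θ hθ t ht hF).not_gt hlt
  -- `t₀ > T₀`
  have ht₀T : T₀ < t₀ := by
    rcases ht₀.1.eq_or_lt with h | h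
    · exact absurd (h ▸ hbot θ₀ hθ₀) (not_lt.mpr hF₀)
    · exact h
  -- `F(·, t₀) ≥ 0` on `[0, b]`
  have hnonneg : ∀ θ ∈ Icc 0 b, 0 ≤ F θ t₀ := by
    intro θ hθ
    by_contra hlt
    push Not at hlt
    have hc : ContinuousWithinAt (fun p : ℝ × ℝ => F p.1 p.2) K (θ, t₀) := hcont _ ⟨hθ, ht₀⟩
    have hγ : Tendsto (fun t : ℝ => (θ, t)) (𝓝[<] t₀) (𝓝[K] (θ, t₀)) := by
      refine tendsto_nhdsWithin_iff.2 ⟨?_, ?_⟩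
      · exact ((continuous_const.prodMk continuous_id).tendsto t₀).mono_left nhdsWithin_le_nhds
      · filter_upwards [Ico_mem_nhdsLT ht₀T] with t ht
        exact ⟨hθ, ht.1, ht.2.le.trans ht₀.2⟩
    have hev : ∀ᶠ t in 𝓝[<] t₀, F θ t < 0 := (hc.tendsto.comp hγ).eventually (gt_mem_nhds hlt)
    obtain ⟨t, hFt, hT₀t, htt₀⟩ := (hev.and (Ico_mem_nhdsLT ht₀T)).exists
    exact (hpos_lt θ hθ t ⟨hT₀t, htt₀.le.trans ht₀.2⟩ htt₀).not_gt hFt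
  have hFeq : F θ₀ t₀ = 0 := le_antisymm hF₀ (hnonneg θ₀ hθ₀)
  -- `θ₀` is interior
  have hθ₀0 : 0 < θ₀ := by
    rcases hθ₀.1.eq_or_lt with h | h
    · rw [← h] at hFeq; exact absurd hFeq (hleft t₀ ht₀).ne'
    · exact h
  have hθ₀b : θ₀ < b := by
    rcases hθ₀.2.lt_or_eq with h | h
    · exact h
    · obtain ⟨θ, hθ, hFθ⟩ := hright t₀ ⟨ht₀T, ht₀.2⟩ (h ▸ hF₀)
      exact absurd (hnonneg θ ⟨hθ.1.le, hθ.2.le⟩) (not_le.mpr hFθ)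
  have hθ₀' : θ₀ ∈ Ioo 0 b := ⟨hθ₀0, hθ₀b⟩
  have ht₀' : t₀ ∈ Ioc T₀ T₁ := ⟨ht₀T, ht₀.2⟩
  -- local minimum of `F(·, t₀)` at `θ₀`
  have hlocmin : IsLocalMin (fun x => F x t₀) θ₀ := by
    filter_upwards [Icc_mem_nhds hθ₀0 hθ₀b] with θ hθ
    rw [hFeq]; exact hnonneg θ hθ
  have hFθ : Fθ θ₀ t₀ = 0 := by
    have := hlocmin.deriv_eq_zero
    rwa [(hderθ θ₀ hθ₀' t₀ ht₀').deriv] at this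
  have hFθθ : 0 ≤ Fθθ θ₀ t₀ := by
    refine nonneg_of_isLocalMin_of_hasDerivAt hlocmin ?_ (hderθθ θ₀ hθ₀' t₀ ht₀')
    filter_upwards [Ioo_mem_nhds hθ₀0 hθ₀b] with x hx
    exact hderθ x hx t₀ ht₀'
  -- `∂_t F (θ₀, t₀) ≤ 0`
  have hFt : Ft θ₀ t₀ ≤ 0 := by
    have hsl : Tendsto (slope (fun s => F θ₀ s) t₀) (𝓝[<] t₀) (𝓝 (Ft θ₀ t₀)) :=
      (hasDerivAt_iff_tendsto_slope.1 (hdert θ₀ hθ₀' t₀ ht₀')).mono_left (nhdsLT_le_nhdsNE t₀)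
    refine le_of_tendsto hsl ?_
    filter_upwards [Ico_mem_nhdsLT ht₀T] with t ht
    rw [slope_def_field, hFeq, sub_zero]
    have hFt' : 0 < F θ₀ t := hpos_lt θ₀ hθ₀ t ⟨ht.1, ht.2.le.trans ht₀.2⟩ ht.2
    exact (div_neg_of_pos_of_neg hFt' (by linarith [ht.2])).le
  have := hop θ₀ hθ₀' t₀ ht₀'
  unfold lswOp at this
  rw [hFθ, mul_zero, add_zero] at this
  nlinarith [mul_nonneg (half_pos hκ).le hFθθ]

/-- **LSW's maximum principle** (p. 7, in the generality used on p. 8). Let `κ > 4`,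
`0 < b ≤ 2π`, and let `G` be continuous on `[0, b] × [T₀, T₁]` with first and second
`θ`-derivatives and a `t`-derivative at every point of `(0, b) × (T₀, T₁]` satisfying `Λ G ≤ 0`
there. Suppose `G ≥ 0` on `t = T₀` and on `θ = 0`, and on the right side `θ = b` either
`G ≥ 0` (Dirichlet) or `∂_θ G ≥ 0` as a one-sided derivative (Neumann; the paper's
"`∂_θ G = 0` on `θ = 2π`"). Then `G ≥ 0` on `[0, b] × [T₀, T₁]`. Proof as printed: apply
`lsw_maxPrinciple_strict` to `F = G + ε θ^{q/2} + ε`, which has `Λ F < 0`, `F ≥ ε` on the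
bottom and left sides and `∂_θ F > 0` at `θ = b`, then let `ε → 0`.
[cite: LawlerSchrammWernerEJP2002, proof of Thm. 1.2 (pp. 7–8)] -/
theorem lsw_maxPrinciple {κ b T₀ T₁ : ℝ} (hκ : 4 < κ) (hb : 0 < b) (hb' : b ≤ 2 * π)
    {G Gθ Gθθ Gt : ℝ → ℝ → ℝ}
    (hcont : ContinuousOn (fun p : ℝ × ℝ => G p.1 p.2) (Icc 0 b ×ˢ Icc T₀ T₁))
    (hderθ : ∀ θ ∈ Ioo 0 b, ∀ t ∈ Ioc T₀ T₁, HasDerivAt (fun x => G x t) (Gθ θ t) θ)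
    (hderθθ : ∀ θ ∈ Ioo 0 b, ∀ t ∈ Ioc T₀ T₁, HasDerivAt (fun x => Gθ x t) (Gθθ θ t) θ)
    (hdert : ∀ θ ∈ Ioo 0 b, ∀ t ∈ Ioc T₀ T₁, HasDerivAt (fun s => G θ s) (Gt θ t) t)
    (hop : ∀ θ ∈ Ioo 0 b, ∀ t ∈ Ioc T₀ T₁, lswOp κ θ (Gθθ θ t) (Gθ θ t) (Gt θ t) ≤ 0)
    (hbot : ∀ θ ∈ Icc 0 b, 0 ≤ G θ T₀)
    (hleft : ∀ t ∈ Icc T₀ T₁, 0 ≤ G 0 t)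
    (hright : (∀ t ∈ Icc T₀ T₁, 0 ≤ G b t) ∨
      ∀ t ∈ Ioc T₀ T₁, ∃ d, 0 ≤ d ∧ HasDerivWithinAt (fun x => G x t) d (Iic b) b) :
    ∀ θ ∈ Icc 0 b, ∀ t ∈ Icc T₀ T₁, 0 ≤ G θ t := by
  intro θ hθ t ht
  set p := lswQ κ / 2 with hp
  have hp0 : 0 < p := by rw [hp]; exact half_pos (lswQ_pos hκ)
  have hθp : 0 ≤ θ ^ p := Real.rpow_nonneg hθ.1 p
  -- it suffices to prove `G + ε (θ^p + 1) > 0` for every `ε > 0`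
  suffices key : ∀ ε, 0 < ε → 0 < G θ t + ε * (θ ^ p + 1) by
    by_contra hneg
    push Not at hneg
    have hε : 0 < -G θ t / (2 * (θ ^ p + 1)) := div_pos (by linarith) (by linarith)
    have := key _ hε
    have e : G θ t + -G θ t / (2 * (θ ^ p + 1)) * (θ ^ p + 1) = G θ t / 2 := by
      field_simp; ring
    rw [e] at this
    linarith
  intro ε hε
  -- the perturbed function and its derivative data
  have hrp : ∀ x, 0 < x → HasDerivAt (fun y : ℝ => ε * (y ^ p + 1)) (ε * (p * x ^ (p - 1))) x :=
    fun x hx => ((Real.hasDerivAt_rpow_const (Or.inl hx.ne')).add_const 1).const_mul ε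
  have hrp2 : ∀ x, 0 < x →
      HasDerivAt (fun y : ℝ => ε * (p * y ^ (p - 1))) (ε * (p * ((p - 1) * x ^ (p - 2)))) x := by
    intro x hx
    have := ((Real.hasDerivAt_rpow_const (p := p - 1) (Or.inl hx.ne')).const_mul p).const_mul ε
    rw [show p - 1 - 1 = p - 2 by ring] at this
    exact this
  refine lsw_maxPrinciple_strict (κ := κ) (b := b) (T₀ := T₀) (T₁ := T₁) (by linarith)
    (F := fun θ t => G θ t + ε * (θ ^ p + 1))
    (Fθ := fun θ t => Gθ θ t + ε * (p * θ ^ (p - 1)))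
    (Fθθ := fun θ t => Gθθ θ t + ε * (p * ((p - 1) * θ ^ (p - 2))))
    (Ft := fun θ t => Gt θ t + 0) ?_ ?_ ?_ ?_ ?_ ?_ ?_ ?_ θ hθ t ht
  · -- continuity
    refine hcont.add (Continuous.continuousOn ?_)
    exact continuous_const.mul ((continuous_fst.rpow_const fun _ => Or.inr hp0.le).add
      continuous_const)
  · intro θ hθ t ht
    exact (hderθ θ hθ t ht).add (hrp θ hθ.1)
  · intro θ hθ t ht
    exact (hderθθ θ hθ t ht).add (hrp2 θ hθ.1)
  · intro θ hθ t ht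
    exact (hdert θ hθ t ht).add (hasDerivAt_const t (ε * (θ ^ p + 1)))
  · intro θ hθ t ht
    rw [lswOp_add]
    have h1 := hop θ hθ t ht
    have h2 := lswOp_rpow_neg hκ hθ.1 (hθ.2.trans_le hb')
    have e : lswOp κ θ (ε * (p * ((p - 1) * θ ^ (p - 2)))) (ε * (p * θ ^ (p - 1))) 0 =
        ε * lswOp κ θ (p * ((p - 1) * θ ^ (p - 2))) (p * θ ^ (p - 1)) 0 := by
      rw [← lswOp_smul, mul_zero]
    rw [e]
    exact add_neg_of_nonpos_of_neg h1 (mul_neg_of_pos_of_neg hε h2)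
  · intro θ hθ
    have := hbot θ hθ
    have := Real.rpow_nonneg hθ.1 p
    nlinarith
  · intro t ht
    have := hleft t ht
    rw [Real.zero_rpow hp0.ne']
    linarith
  · intro t ht hle
    rcases hright with hD | hN
    · have := hD t ⟨ht.1.le, ht.2⟩
      have := Real.rpow_nonneg hb.le p
      exfalso; linarith [mul_pos hε (by linarith : (0 : ℝ) < b ^ p + 1)]
    · obtain ⟨d, hd, hder⟩ := hN t ht
      have hD : 0 < d + ε * (p * b ^ (p - 1)) := by
        have := Real.rpow_pos_of_pos hb (p - 1)
        positivity
      have hder' : HasDerivWithinAt (fun x => G x t + ε * (x ^ p + 1))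
          (d + ε * (p * b ^ (p - 1))) (Iio b) b :=
        (hder.add (hrp b hb).hasDerivWithinAt).mono Iio_subset_Iic_self
      have hsl := hasDerivWithinAt_iff_tendsto_slope.1 hder'
      rw [Set.sdiff_singleton_eq_self (by simp)] at hsl
      have hev : ∀ᶠ x in 𝓝[<] b, 0 < slope (fun x => G x t + ε * (x ^ p + 1)) b x :=
        (tendsto_order.1 hsl).1 0 hD
      obtain ⟨x, hx, hxb⟩ := (hev.and (Ioo_mem_nhdsLT hb)).exists
      refine ⟨x, hxb, ?_⟩
      rw [slope_def_field] at hx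
      have hden : x - b < 0 := by linarith [hxb.2]
      rcases div_pos_iff.1 hx with ⟨_, h2⟩ | ⟨h1, _⟩
      · exact absurd h2 (not_lt.mpr hden.le)
      · linarith

/-! ### (2.17): comparison with `H` -/

section Comparison

variable {κ : ℝ} {g gθ gθθ gt : ℝ → ℝ → ℝ}

/-- Derivative data of the auxiliary function `2 - 2t - θ²` in `θ`. [folklore] -/
theorem hasDerivAt_lswAux_theta (t θ : ℝ) :
    HasDerivAt (fun x : ℝ => (2 : ℝ) - 2 * t - x ^ 2) (-2 * θ) θ :=
  ((hasDerivAt_pow 2 θ).const_sub ((2 : ℝ) - 2 * t)).congr_deriv (by norm_num)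

/-- Second derivative data of `2 - 2t - θ²` in `θ`. [folklore] -/
theorem hasDerivAt_lswAux_theta_two (θ : ℝ) : HasDerivAt (fun x : ℝ => -2 * x) (-2) θ :=
  ((hasDerivAt_id θ).const_mul (-2 : ℝ)).congr_deriv (by ring)

/-- Derivative data of `2 - 2t - θ²` in `t`. [folklore] -/
theorem hasDerivAt_lswAux_t (θ t : ℝ) :
    HasDerivAt (fun s : ℝ => (2 : ℝ) - 2 * s - θ ^ 2) (-2) t :=
  ((((hasDerivAt_id t).const_mul (2 : ℝ)).const_sub (2 : ℝ)).sub_const (θ ^ 2)).congr_deriv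
    (by ring)

/-- **Step 1 of the proof of (2.17), upper function** (LSW p. 8): with
`F₁ = c₁ H - g + 2 - 2t - θ²` and `c₁` so large that `F₁ ≥ 0` on `{π} × [0, 1]` and on
`[0, π] × {0}`, the maximum principle on `[0, π] × [0, 1]` gives `F₁(θ, 1) ≥ 0`, i.e.
`g(θ, 1) + θ² ≤ c₁ H(θ, 1)` for `θ ∈ [0, π]`.
[cite: LawlerSchrammWernerEJP2002, proof of Thm. 1.2 (p. 8)] -/
theorem lsw_comparison_step1_upper (hκ : 4 < κ)
    (hcont : ContinuousOn (fun p : ℝ × ℝ => g p.1 p.2) (Icc 0 π ×ˢ Icc 0 1))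
    (hderθ : ∀ θ ∈ Ioo 0 (2 * π), ∀ t ∈ Ioi (0 : ℝ), HasDerivAt (fun x => g x t) (gθ θ t) θ)
    (hderθθ : ∀ θ ∈ Ioo 0 (2 * π), ∀ t ∈ Ioi (0 : ℝ), HasDerivAt (fun x => gθ x t) (gθθ θ t) θ)
    (hdert : ∀ θ ∈ Ioo 0 (2 * π), ∀ t ∈ Ioi (0 : ℝ), HasDerivAt (fun s => g θ s) (gt θ t) t)
    (hpde : ∀ θ ∈ Ioo 0 (2 * π), ∀ t ∈ Ioi (0 : ℝ), lswOp κ θ (gθθ θ t) (gθ θ t) (gt θ t) = 0)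
    (hdir : ∀ t, 0 < t → g 0 t = 0)
    (hbd : ∀ θ ∈ Icc 0 (2 * π), ∀ t, 0 ≤ t → g θ t ∈ Icc (0 : ℝ) 1)
    {c₁ : ℝ} (hc₁ : 0 ≤ c₁)
    (hc₁A : 1 + π ^ 2 ≤ c₁ * (Real.sin (π / 4) ^ lswQ κ * Real.exp (-(lswLambda κ * 1))))
    (hc₁B : π ^ 2 ≤ c₁ * (Real.sin (1 / 4) ^ lswQ κ * Real.exp (-(lswLambda κ * 0)))) :
    ∀ θ ∈ Icc 0 π, g θ 1 + θ ^ 2 ≤ c₁ * lswH κ θ 1 := by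
  have hπ := Real.pi_pos
  have hsin : ∀ θ ∈ Ioo 0 (2 * π), Real.sin (θ / 4) ≠ 0 :=
    fun θ hθ => (sin_quarter_pos hθ.1 hθ.2.le).ne'
  have hHcont := continuous_lswH hκ
  have hauxc : Continuous fun p : ℝ × ℝ => (2 : ℝ) - 2 * p.2 - p.1 ^ 2 := by fun_prop
  intro θ hθ
  have key := lsw_maxPrinciple (κ := κ) (b := π) (T₀ := 0) (T₁ := 1) hκ hπ (by linarith)
    (G := fun θ t => c₁ * lswH κ θ t - g θ t + (2 - 2 * t - θ ^ 2))
    (Gθ := fun θ t => c₁ * lswHθ κ θ t - gθ θ t + (-2 * θ))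
    (Gθθ := fun θ t => c₁ * lswHθθ κ θ t - gθθ θ t + (-2))
    (Gt := fun θ t => c₁ * (-lswLambda κ * lswH κ θ t) - gt θ t + (-2))
    (((hHcont.continuousOn.const_smul c₁).sub hcont).add hauxc.continuousOn)
    (fun θ hθ t ht => (((hasDerivAt_lswH_theta t (hsin θ ⟨hθ.1, by linarith [hθ.2]⟩)).const_mul
      c₁).sub (hderθ θ ⟨hθ.1, by linarith [hθ.2]⟩ t ht.1)).add (hasDerivAt_lswAux_theta t θ))
    (fun θ hθ t ht => (((hasDerivAt_lswHθ_theta t (hsin θ ⟨hθ.1, by linarith [hθ.2]⟩)).const_mul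
      c₁).sub (hderθθ θ ⟨hθ.1, by linarith [hθ.2]⟩ t ht.1)).add (hasDerivAt_lswAux_theta_two θ))
    (fun θ hθ t ht => (((hasDerivAt_lswH_t κ θ t).const_mul c₁).sub
      (hdert θ ⟨hθ.1, by linarith [hθ.2]⟩ t ht.1)).add (hasDerivAt_lswAux_t θ t))
    ?_ ?_ ?_ (Or.inl ?_) θ hθ 1 ⟨zero_le_one, le_rfl⟩
  · -- conclusion from `F₁(θ, 1) ≥ 0`
    linarith
  · -- `Λ F₁ < 0 ≤ 0`
    intro θ hθ t ht
    have hθ' : θ ∈ Ioo 0 (2 * π) := ⟨hθ.1, by linarith [hθ.2]⟩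
    have e : lswOp κ θ (c₁ * lswHθθ κ θ t - gθθ θ t + -2) (c₁ * lswHθ κ θ t - gθ θ t + -2 * θ)
        (c₁ * (-lswLambda κ * lswH κ θ t) - gt θ t + -2) =
        c₁ * lswOp κ θ (lswHθθ κ θ t) (lswHθ κ θ t) (-lswLambda κ * lswH κ θ t) -
          lswOp κ θ (gθθ θ t) (gθ θ t) (gt θ t) + lswOp κ θ (-2) (-2 * θ) (-2) := by
      unfold lswOp; ring
    rw [e, lswOp_lswH hκ hθ'.1 hθ'.2, hpde θ hθ' t ht.1]
    have := lswOp_lswAux_neg (κ := κ) (by linarith) hθ.1 hθ.2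
    linarith
  · -- bottom side `t = 0`
    intro θ hθ
    have hg := (hbd θ ⟨hθ.1, by linarith [hθ.2]⟩ 0 le_rfl).2
    have hH0 : 0 ≤ c₁ * lswH κ θ 0 := mul_nonneg hc₁ (lswH_nonneg hθ.1 (by linarith [hθ.2]) 0)
    show 0 ≤ c₁ * lswH κ θ 0 - g θ 0 + (2 - 2 * 0 - θ ^ 2)
    rcases le_or_gt θ 1 with hθ1 | hθ1
    · have : θ ^ 2 ≤ 1 := by nlinarith [hθ.1]
      linarith
    · have hH : c₁ * (Real.sin (1 / 4) ^ lswQ κ * Real.exp (-(lswLambda κ * 0))) ≤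
          c₁ * lswH κ θ 0 :=
        mul_le_mul_of_nonneg_left (lswH_ge hκ zero_le_one hθ1.le (by linarith [hθ.2]) le_rfl) hc₁
      have : θ ^ 2 ≤ π ^ 2 := by nlinarith [hθ.1, hθ.2]
      linarith
  · -- left side `θ = 0`
    intro t ht
    show 0 ≤ c₁ * lswH κ 0 t - g 0 t + (2 - 2 * t - 0 ^ 2)
    rw [lswH_zero_left hκ]
    rcases ht.1.eq_or_lt with h | h
    · rw [← h]; have := (hbd 0 ⟨le_rfl, by linarith⟩ 0 le_rfl).2; linarith
    · rw [hdir t h]; linarith [ht.2]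
  · -- right side `θ = π`
    intro t ht
    show 0 ≤ c₁ * lswH κ π t - g π t + (2 - 2 * t - π ^ 2)
    have hg := (hbd π ⟨hπ.le, by linarith⟩ t ht.1).2
    have hH : c₁ * (Real.sin (π / 4) ^ lswQ κ * Real.exp (-(lswLambda κ * 1))) ≤
        c₁ * lswH κ π t :=
      mul_le_mul_of_nonneg_left (lswH_ge hκ hπ.le le_rfl (by linarith) ht.2) hc₁
    linarith [ht.2]

/-- **Step 1 of the proof of (2.17), lower function** (LSW p. 8): with
`F₂ = c₂ g - H + 2 - 2t - θ²` and `c₂` so large that `F₂ ≥ 0` on `{π} × [0, 1]` and on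
`[0, π] × {0}` (this uses lower bounds `m₁ ≤ g` on `{π} × [0, 1]` and `m₂ ≤ g` on
`[1, π] × {0}`), the maximum principle gives `H(θ, 1) + θ² ≤ c₂ g(θ, 1)` for `θ ∈ [0, π]`.
[cite: LawlerSchrammWernerEJP2002, proof of Thm. 1.2 (p. 8)] -/
theorem lsw_comparison_step1_lower (hκ : 4 < κ)
    (hcont : ContinuousOn (fun p : ℝ × ℝ => g p.1 p.2) (Icc 0 π ×ˢ Icc 0 1))
    (hderθ : ∀ θ ∈ Ioo 0 (2 * π), ∀ t ∈ Ioi (0 : ℝ), HasDerivAt (fun x => g x t) (gθ θ t) θ)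
    (hderθθ : ∀ θ ∈ Ioo 0 (2 * π), ∀ t ∈ Ioi (0 : ℝ), HasDerivAt (fun x => gθ x t) (gθθ θ t) θ)
    (hdert : ∀ θ ∈ Ioo 0 (2 * π), ∀ t ∈ Ioi (0 : ℝ), HasDerivAt (fun s => g θ s) (gt θ t) t)
    (hpde : ∀ θ ∈ Ioo 0 (2 * π), ∀ t ∈ Ioi (0 : ℝ), lswOp κ θ (gθθ θ t) (gθ θ t) (gt θ t) = 0)
    (hbd : ∀ θ ∈ Icc 0 (2 * π), ∀ t, 0 ≤ t → g θ t ∈ Icc (0 : ℝ) 1)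
    {m₁ m₂ c₂ : ℝ} (hm₁ : ∀ t ∈ Icc (0 : ℝ) 1, m₁ ≤ g π t) (hm₂ : ∀ θ ∈ Icc (1 : ℝ) π, m₂ ≤ g θ 0)
    (hc₂ : 0 ≤ c₂) (hc₂m₁ : 1 + π ^ 2 ≤ c₂ * m₁) (hc₂m₂ : π ^ 2 ≤ c₂ * m₂) :
    ∀ θ ∈ Icc 0 π, lswH κ θ 1 + θ ^ 2 ≤ c₂ * g θ 1 := by
  have hπ := Real.pi_pos
  have hsin : ∀ θ ∈ Ioo 0 (2 * π), Real.sin (θ / 4) ≠ 0 :=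
    fun θ hθ => (sin_quarter_pos hθ.1 hθ.2.le).ne'
  have hHcont := continuous_lswH hκ
  have hauxc : Continuous fun p : ℝ × ℝ => (2 : ℝ) - 2 * p.2 - p.1 ^ 2 := by fun_prop
  intro θ hθ
  have key := lsw_maxPrinciple (κ := κ) (b := π) (T₀ := 0) (T₁ := 1) hκ hπ (by linarith)
    (G := fun θ t => c₂ * g θ t - lswH κ θ t + (2 - 2 * t - θ ^ 2))
    (Gθ := fun θ t => c₂ * gθ θ t - lswHθ κ θ t + (-2 * θ))
    (Gθθ := fun θ t => c₂ * gθθ θ t - lswHθθ κ θ t + (-2))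
    (Gt := fun θ t => c₂ * gt θ t - (-lswLambda κ * lswH κ θ t) + (-2))
    (((hcont.const_smul c₂).sub hHcont.continuousOn).add hauxc.continuousOn)
    (fun θ hθ t ht => (((hderθ θ ⟨hθ.1, by linarith [hθ.2]⟩ t ht.1).const_mul c₂).sub
      (hasDerivAt_lswH_theta t (hsin θ ⟨hθ.1, by linarith [hθ.2]⟩))).add
      (hasDerivAt_lswAux_theta t θ))
    (fun θ hθ t ht => (((hderθθ θ ⟨hθ.1, by linarith [hθ.2]⟩ t ht.1).const_mul c₂).sub
      (hasDerivAt_lswHθ_theta t (hsin θ ⟨hθ.1, by linarith [hθ.2]⟩))).add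
      (hasDerivAt_lswAux_theta_two θ))
    (fun θ hθ t ht => (((hdert θ ⟨hθ.1, by linarith [hθ.2]⟩ t ht.1).const_mul c₂).sub
      (hasDerivAt_lswH_t κ θ t)).add (hasDerivAt_lswAux_t θ t))
    ?_ ?_ ?_ (Or.inl ?_) θ hθ 1 ⟨zero_le_one, le_rfl⟩
  · linarith
  · intro θ hθ t ht
    have hθ' : θ ∈ Ioo 0 (2 * π) := ⟨hθ.1, by linarith [hθ.2]⟩
    have e : lswOp κ θ (c₂ * gθθ θ t - lswHθθ κ θ t + -2) (c₂ * gθ θ t - lswHθ κ θ t + -2 * θ)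
        (c₂ * gt θ t - (-lswLambda κ * lswH κ θ t) + -2) =
        c₂ * lswOp κ θ (gθθ θ t) (gθ θ t) (gt θ t) -
          lswOp κ θ (lswHθθ κ θ t) (lswHθ κ θ t) (-lswLambda κ * lswH κ θ t) +
          lswOp κ θ (-2) (-2 * θ) (-2) := by
      unfold lswOp; ring
    rw [e, lswOp_lswH hκ hθ'.1 hθ'.2, hpde θ hθ' t ht.1]
    have := lswOp_lswAux_neg (κ := κ) (by linarith) hθ.1 hθ.2
    linarith
  · -- bottom side `t = 0`
    intro θ hθ
    have hg := (hbd θ ⟨hθ.1, by linarith [hθ.2]⟩ 0 le_rfl).1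
    have hH1 : lswH κ θ 0 ≤ 1 := lswH_le_one hκ hθ.1 (by linarith [hθ.2]) le_rfl
    have hcg : 0 ≤ c₂ * g θ 0 := mul_nonneg hc₂ hg
    show 0 ≤ c₂ * g θ 0 - lswH κ θ 0 + (2 - 2 * 0 - θ ^ 2)
    rcases le_or_gt θ 1 with hθ1 | hθ1
    · have : θ ^ 2 ≤ 1 := by nlinarith [hθ.1]
      linarith
    · have hgm : c₂ * m₂ ≤ c₂ * g θ 0 := mul_le_mul_of_nonneg_left (hm₂ θ ⟨hθ1.le, hθ.2⟩) hc₂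
      have : θ ^ 2 ≤ π ^ 2 := by nlinarith [hθ.1, hθ.2]
      linarith
  · -- left side `θ = 0`
    intro t ht
    show 0 ≤ c₂ * g 0 t - lswH κ 0 t + (2 - 2 * t - 0 ^ 2)
    rw [lswH_zero_left hκ]
    have := mul_nonneg hc₂ (hbd 0 ⟨le_rfl, by linarith⟩ t ht.1).1
    linarith [ht.2]
  · -- right side `θ = π`
    intro t ht
    show 0 ≤ c₂ * g π t - lswH κ π t + (2 - 2 * t - π ^ 2)
    have hgm : c₂ * m₁ ≤ c₂ * g π t := mul_le_mul_of_nonneg_left (hm₁ t ht) hc₂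
    have hH1 : lswH κ π t ≤ 1 := lswH_le_one hκ hπ.le (by linarith) ht.1
    linarith [ht.1, ht.2]

/-- **Step 3 of the proof of (2.17)** (LSW p. 8: "Yet another application of the same Maximum
Principle argument, this time in the range `[0, 2π] × [1, ∞)`"): if `c₁ H - g ≥ 0` and
`c₂ g - H ≥ 0` at `t = 1` on `[0, 2π]`, then, `g` satisfying `Λ g = 0`, the Dirichlet condition
at `θ = 0` and the Neumann condition at `θ = 2π`, the same inequalities hold for all `t ≥ 1`.
[cite: LawlerSchrammWernerEJP2002, proof of Thm. 1.2 (p. 8)] -/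
theorem lsw_comparison_step3 (hκ : 4 < κ)
    (hcont : ContinuousOn (fun p : ℝ × ℝ => g p.1 p.2) (Icc 0 (2 * π) ×ˢ Ici 1))
    (hderθ : ∀ θ ∈ Ioo 0 (2 * π), ∀ t ∈ Ioi (0 : ℝ), HasDerivAt (fun x => g x t) (gθ θ t) θ)
    (hderθθ : ∀ θ ∈ Ioo 0 (2 * π), ∀ t ∈ Ioi (0 : ℝ), HasDerivAt (fun x => gθ x t) (gθθ θ t) θ)
    (hdert : ∀ θ ∈ Ioo 0 (2 * π), ∀ t ∈ Ioi (0 : ℝ), HasDerivAt (fun s => g θ s) (gt θ t) t)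
    (hpde : ∀ θ ∈ Ioo 0 (2 * π), ∀ t ∈ Ioi (0 : ℝ), lswOp κ θ (gθθ θ t) (gθ θ t) (gt θ t) = 0)
    (hdir : ∀ t, 0 < t → g 0 t = 0)
    (hneu : ∀ t, 0 < t → HasDerivWithinAt (fun x => g x t) 0 (Iic (2 * π)) (2 * π))
    {c₁ c₂ : ℝ} (h₁ : ∀ θ ∈ Icc 0 (2 * π), g θ 1 ≤ c₁ * lswH κ θ 1)
    (h₂ : ∀ θ ∈ Icc 0 (2 * π), lswH κ θ 1 ≤ c₂ * g θ 1) :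
    ∀ t, 1 ≤ t → ∀ θ ∈ Icc 0 (2 * π), g θ t ≤ c₁ * lswH κ θ t ∧ lswH κ θ t ≤ c₂ * g θ t := by
  have hπ := Real.pi_pos
  have h2π : (0 : ℝ) < 2 * π := by linarith
  have hsin : ∀ θ ∈ Ioo 0 (2 * π), Real.sin (θ / 4) ≠ 0 :=
    fun θ hθ => (sin_quarter_pos hθ.1 hθ.2.le).ne'
  have hs2π : Real.sin (2 * π / 4) ≠ 0 := by
    rw [show 2 * π / 4 = π / 2 by ring, Real.sin_pi_div_two]; exact one_ne_zero
  have hHcont := continuous_lswH hκ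
  intro T hT θ hθ
  have h01 : ∀ t ∈ Ioc (1 : ℝ) T, t ∈ Ioi (0 : ℝ) := fun t ht => lt_trans zero_lt_one ht.1
  have hcontT : ContinuousOn (fun p : ℝ × ℝ => g p.1 p.2) (Icc 0 (2 * π) ×ˢ Icc 1 T) :=
    hcont.mono (prod_mono le_rfl Icc_subset_Ici_self)
  constructor
  · have key := lsw_maxPrinciple (κ := κ) (b := 2 * π) (T₀ := 1) (T₁ := T) hκ h2π le_rfl
      (G := fun θ t => c₁ * lswH κ θ t - g θ t)
      (Gθ := fun θ t => c₁ * lswHθ κ θ t - gθ θ t)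
      (Gθθ := fun θ t => c₁ * lswHθθ κ θ t - gθθ θ t)
      (Gt := fun θ t => c₁ * (-lswLambda κ * lswH κ θ t) - gt θ t)
      ((hHcont.continuousOn.const_smul c₁).sub hcontT)
      (fun θ hθ t ht => ((hasDerivAt_lswH_theta t (hsin θ hθ)).const_mul c₁).sub
        (hderθ θ hθ t (h01 t ht)))
      (fun θ hθ t ht => ((hasDerivAt_lswHθ_theta t (hsin θ hθ)).const_mul c₁).sub
        (hderθθ θ hθ t (h01 t ht)))
      (fun θ hθ t ht => ((hasDerivAt_lswH_t κ θ t).const_mul c₁).sub (hdert θ hθ t (h01 t ht)))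
      ?_ ?_ ?_ (Or.inr ?_) θ hθ T ⟨hT, le_rfl⟩
    · linarith
    · intro θ hθ t ht
      have e : lswOp κ θ (c₁ * lswHθθ κ θ t - gθθ θ t) (c₁ * lswHθ κ θ t - gθ θ t)
          (c₁ * (-lswLambda κ * lswH κ θ t) - gt θ t) =
          c₁ * lswOp κ θ (lswHθθ κ θ t) (lswHθ κ θ t) (-lswLambda κ * lswH κ θ t) -
            lswOp κ θ (gθθ θ t) (gθ θ t) (gt θ t) := by
        unfold lswOp; ring
      rw [e, lswOp_lswH hκ hθ.1 hθ.2, hpde θ hθ t (h01 t ht)]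
      simp
    · intro θ hθ
      show 0 ≤ c₁ * lswH κ θ 1 - g θ 1
      linarith [h₁ θ hθ]
    · intro t ht
      show 0 ≤ c₁ * lswH κ 0 t - g 0 t
      rw [lswH_zero_left hκ, hdir t (by linarith [ht.1])]; simp
    · intro t ht
      refine ⟨c₁ * lswHθ κ (2 * π) t - 0, by rw [lswHθ_two_pi]; simp, ?_⟩
      exact ((hasDerivAt_lswH_theta t hs2π).const_mul c₁).hasDerivWithinAt.sub
        (hneu t (by linarith [ht.1]))
  · have key := lsw_maxPrinciple (κ := κ) (b := 2 * π) (T₀ := 1) (T₁ := T) hκ h2π le_rfl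
      (G := fun θ t => c₂ * g θ t - lswH κ θ t)
      (Gθ := fun θ t => c₂ * gθ θ t - lswHθ κ θ t)
      (Gθθ := fun θ t => c₂ * gθθ θ t - lswHθθ κ θ t)
      (Gt := fun θ t => c₂ * gt θ t - (-lswLambda κ * lswH κ θ t))
      ((hcontT.const_smul c₂).sub hHcont.continuousOn)
      (fun θ hθ t ht => ((hderθ θ hθ t (h01 t ht)).const_mul c₂).sub
        (hasDerivAt_lswH_theta t (hsin θ hθ)))
      (fun θ hθ t ht => ((hderθθ θ hθ t (h01 t ht)).const_mul c₂).sub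
        (hasDerivAt_lswHθ_theta t (hsin θ hθ)))
      (fun θ hθ t ht => ((hdert θ hθ t (h01 t ht)).const_mul c₂).sub (hasDerivAt_lswH_t κ θ t))
      ?_ ?_ ?_ (Or.inr ?_) θ hθ T ⟨hT, le_rfl⟩
    · linarith
    · intro θ hθ t ht
      have e : lswOp κ θ (c₂ * gθθ θ t - lswHθθ κ θ t) (c₂ * gθ θ t - lswHθ κ θ t)
          (c₂ * gt θ t - (-lswLambda κ * lswH κ θ t)) =
          c₂ * lswOp κ θ (gθθ θ t) (gθ θ t) (gt θ t) -
            lswOp κ θ (lswHθθ κ θ t) (lswHθ κ θ t) (-lswLambda κ * lswH κ θ t) := by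
        unfold lswOp; ring
      rw [e, lswOp_lswH hκ hθ.1 hθ.2, hpde θ hθ t (h01 t ht)]
      simp
    · intro θ hθ
      show 0 ≤ c₂ * g θ 1 - lswH κ θ 1
      linarith [h₂ θ hθ]
    · intro t ht
      show 0 ≤ c₂ * g 0 t - lswH κ 0 t
      rw [lswH_zero_left hκ, hdir t (by linarith [ht.1])]; simp
    · intro t ht
      refine ⟨c₂ * 0 - lswHθ κ (2 * π) t, by rw [lswHθ_two_pi]; simp, ?_⟩
      exact ((hneu t (by linarith [ht.1])).const_mul c₂).sub
        (hasDerivAt_lswH_theta t hs2π).hasDerivWithinAt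

/-- **Lawler–Schramm–Werner 2002, (2.17)** (proof of Theorem 1.2, pp. 7–8), the deterministic
half of LSW Theorem 1.2, for every `κ > 4`. Let `g : [0, 2π] × [0, ∞) → ℝ` (the paper's
`h̃(θ, t) = ∫₀¹ h(θ, t + s) ds`) be continuous, with first and second `θ`-derivatives `gθ`,
`gθθ` and `t`-derivative `gt` on `S = (0, 2π) × (0, ∞)` satisfying the PDE (2.4)
`Λ g = (κ/2) ∂²_θ g + cot(θ/2) ∂_θ g - ∂_t g = 0` in `S`, the Dirichlet condition
`g(0, t) = 0` for `t > 0`, the Neumann condition (2.12) `∂_θ g(2π, t) = 0` (one-sided) for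
`t > 0`, the bounds `0 ≤ g ≤ 1`, and positivity `g > 0` on `(0, 2π] × [0, ∞)` (the paper's
"`h̃(θ, 0) > 0` for `θ ∈ (0, 2π]`" together with its uses on p. 8). Then there are constants
`c, c' > 0` such that
`∀ t ≥ 1, ∀ θ ∈ [0, 2π], c H(θ, t) ≤ g(θ, t) ≤ c' H(θ, t)`, `H(θ, t) = sin(θ/4)^q e^{-λ t}`,
`λ = (κ² - 16)/(32κ)` (`= 5/48` for `κ = 6`). Proof as printed (p. 8): steps 1–3 above, the
constants `c₁`, `c₂` being produced from positive minima of `g` on the compact segments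
`{π} × [0, 1]`, `[1, π] × {0}`, `[π, 2π] × {1}`.
[cite: LawlerSchrammWernerEJP2002, proof of Thm. 1.2, (2.17) (pp. 7–8)] -/
theorem LawlerSchrammWerner2002_comparison (hκ : 4 < κ)
    (hcont : ContinuousOn (fun p : ℝ × ℝ => g p.1 p.2) (Icc 0 (2 * π) ×ˢ Ici 0))
    (hderθ : ∀ θ ∈ Ioo 0 (2 * π), ∀ t ∈ Ioi (0 : ℝ), HasDerivAt (fun x => g x t) (gθ θ t) θ)
    (hderθθ : ∀ θ ∈ Ioo 0 (2 * π), ∀ t ∈ Ioi (0 : ℝ), HasDerivAt (fun x => gθ x t) (gθθ θ t) θ)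
    (hdert : ∀ θ ∈ Ioo 0 (2 * π), ∀ t ∈ Ioi (0 : ℝ), HasDerivAt (fun s => g θ s) (gt θ t) t)
    (hpde : ∀ θ ∈ Ioo 0 (2 * π), ∀ t ∈ Ioi (0 : ℝ), lswOp κ θ (gθθ θ t) (gθ θ t) (gt θ t) = 0)
    (hdir : ∀ t, 0 < t → g 0 t = 0)
    (hneu : ∀ t, 0 < t → HasDerivWithinAt (fun x => g x t) 0 (Iic (2 * π)) (2 * π))
    (hbd : ∀ θ ∈ Icc 0 (2 * π), ∀ t, 0 ≤ t → g θ t ∈ Icc (0 : ℝ) 1)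
    (hpos : ∀ θ ∈ Ioc 0 (2 * π), ∀ t, 0 ≤ t → 0 < g θ t) :
    ∃ c c' : ℝ, 0 < c ∧ 0 < c' ∧ ∀ t, 1 ≤ t → ∀ θ ∈ Icc 0 (2 * π),
      c * lswH κ θ t ≤ g θ t ∧ g θ t ≤ c' * lswH κ θ t := by
  have hπ := Real.pi_pos
  have hπ3 : (3 : ℝ) < π := Real.pi_gt_three
  -- the constants `A = H(π, 1)` and `B = H(1, 0) = sin(1/4)^q`
  have hA0 : 0 < Real.sin (π / 4) ^ lswQ κ * Real.exp (-(lswLambda κ * 1)) :=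
    mul_pos (Real.rpow_pos_of_pos (sin_quarter_pos hπ (by linarith)) _) (Real.exp_pos _)
  have hB0 : 0 < Real.sin (1 / 4) ^ lswQ κ * Real.exp (-(lswLambda κ * 0)) :=
    mul_pos (Real.rpow_pos_of_pos (sin_quarter_pos one_pos (by linarith)) _) (Real.exp_pos _)
  set A := Real.sin (π / 4) ^ lswQ κ * Real.exp (-(lswLambda κ * 1)) with hA
  set B := Real.sin (1 / 4) ^ lswQ κ * Real.exp (-(lswLambda κ * 0)) with hB
  -- positive minima of `g` on three compact segments
  have hseg1 : ∃ m₁, 0 < m₁ ∧ ∀ t ∈ Icc (0 : ℝ) 1, m₁ ≤ g π t := by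
    have hc : ContinuousOn (fun t : ℝ => g π t) (Icc 0 1) :=
      hcont.comp (continuous_const.prodMk continuous_id).continuousOn
        fun t ht => show (π, t) ∈ Icc 0 (2 * π) ×ˢ Ici 0 from
          Set.mk_mem_prod ⟨hπ.le, (by linarith : π ≤ 2 * π)⟩ (Set.mem_Ici.2 ht.1)
    obtain ⟨t₀, ht₀, hmin⟩ := isCompact_Icc.exists_isMinOn (nonempty_Icc.2 zero_le_one) hc
    exact ⟨g π t₀, hpos π ⟨hπ, by linarith⟩ t₀ ht₀.1, fun t ht => hmin ht⟩
  have hseg2 : ∃ m₂, 0 < m₂ ∧ ∀ θ ∈ Icc (1 : ℝ) π, m₂ ≤ g θ 0 := by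
    have hc : ContinuousOn (fun θ : ℝ => g θ 0) (Icc 1 π) :=
      hcont.comp (continuous_id.prodMk continuous_const).continuousOn
        fun θ hθ => show (θ, (0 : ℝ)) ∈ Icc 0 (2 * π) ×ˢ Ici 0 from
          Set.mk_mem_prod ⟨(by linarith [hθ.1] : (0 : ℝ) ≤ θ), (by linarith [hθ.2] : θ ≤ 2 * π)⟩
            (Set.mem_Ici.2 le_rfl)
    obtain ⟨θ₀, hθ₀, hmin⟩ := isCompact_Icc.exists_isMinOn (nonempty_Icc.2 (by linarith)) hc
    exact ⟨g θ₀ 0, hpos θ₀ ⟨by linarith [hθ₀.1], by linarith [hθ₀.2]⟩ 0 le_rfl,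
      fun θ hθ => hmin hθ⟩
  have hseg3 : ∃ m₃, 0 < m₃ ∧ ∀ θ ∈ Icc π (2 * π), m₃ ≤ g θ 1 := by
    have hc : ContinuousOn (fun θ : ℝ => g θ 1) (Icc π (2 * π)) :=
      hcont.comp (continuous_id.prodMk continuous_const).continuousOn
        fun θ hθ => show (θ, (1 : ℝ)) ∈ Icc 0 (2 * π) ×ˢ Ici 0 from
          Set.mk_mem_prod ⟨(by linarith [hθ.1] : (0 : ℝ) ≤ θ), hθ.2⟩ (Set.mem_Ici.2 zero_le_one)
    obtain ⟨θ₀, hθ₀, hmin⟩ := isCompact_Icc.exists_isMinOn (nonempty_Icc.2 (by linarith)) hc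
    exact ⟨g θ₀ 1, hpos θ₀ ⟨by linarith [hθ₀.1], hθ₀.2⟩ 1 zero_le_one, fun θ hθ => hmin hθ⟩
  obtain ⟨m₁, hm₁, hg₁⟩ := hseg1
  obtain ⟨m₂, hm₂, hg₂⟩ := hseg2
  obtain ⟨m₃, hm₃, hg₃⟩ := hseg3
  -- the constants `c₁`, `c₂`
  set c₁ : ℝ := (1 + π ^ 2) / A + π ^ 2 / B with hc₁
  set c₂ : ℝ := (1 + π ^ 2) / m₁ + π ^ 2 / m₂ + 1 / m₃ with hc₂
  have hc₁0 : 0 < c₁ := by positivity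
  have hc₂0 : 0 < c₂ := by positivity
  have hxA : 0 ≤ (1 + π ^ 2) / A := by positivity
  have hxB : 0 ≤ π ^ 2 / B := by positivity
  have hx₁ : 0 ≤ (1 + π ^ 2) / m₁ := by positivity
  have hx₂ : 0 ≤ π ^ 2 / m₂ := by positivity
  have hx₃ : 0 ≤ 1 / m₃ := by positivity
  have hc₁A : 1 + π ^ 2 ≤ c₁ * A := by
    have e : (1 + π ^ 2) / A * A = 1 + π ^ 2 := div_mul_cancel₀ _ hA0.ne'
    have : c₁ * A = (1 + π ^ 2) / A * A + π ^ 2 / B * A := by rw [hc₁]; ring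
    rw [this, e]; linarith [mul_nonneg hxB hA0.le]
  have hc₁B : π ^ 2 ≤ c₁ * B := by
    have e : π ^ 2 / B * B = π ^ 2 := div_mul_cancel₀ _ hB0.ne'
    have : c₁ * B = (1 + π ^ 2) / A * B + π ^ 2 / B * B := by rw [hc₁]; ring
    rw [this, e]; linarith [mul_nonneg hxA hB0.le]
  have hc₂m₁ : 1 + π ^ 2 ≤ c₂ * m₁ := by
    have e : (1 + π ^ 2) / m₁ * m₁ = 1 + π ^ 2 := div_mul_cancel₀ _ hm₁.ne'
    have : c₂ * m₁ = (1 + π ^ 2) / m₁ * m₁ + π ^ 2 / m₂ * m₁ + 1 / m₃ * m₁ := by rw [hc₂]; ring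
    rw [this, e]; linarith [mul_nonneg hx₂ hm₁.le, mul_nonneg hx₃ hm₁.le]
  have hc₂m₂ : π ^ 2 ≤ c₂ * m₂ := by
    have e : π ^ 2 / m₂ * m₂ = π ^ 2 := div_mul_cancel₀ _ hm₂.ne'
    have : c₂ * m₂ = (1 + π ^ 2) / m₁ * m₂ + π ^ 2 / m₂ * m₂ + 1 / m₃ * m₂ := by rw [hc₂]; ring
    rw [this, e]; linarith [mul_nonneg hx₁ hm₂.le, mul_nonneg hx₃ hm₂.le]
  have hc₂m₃ : 1 ≤ c₂ * m₃ := by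
    have e : 1 / m₃ * m₃ = 1 := div_mul_cancel₀ _ hm₃.ne'
    have : c₂ * m₃ = (1 + π ^ 2) / m₁ * m₃ + π ^ 2 / m₂ * m₃ + 1 / m₃ * m₃ := by rw [hc₂]; ring
    rw [this, e]; linarith [mul_nonneg hx₁ hm₃.le, mul_nonneg hx₂ hm₃.le]
  -- Step 1 on `[0, π] × [0, 1]`
  have hcont1 : ContinuousOn (fun p : ℝ × ℝ => g p.1 p.2) (Icc 0 π ×ˢ Icc 0 1) :=
    hcont.mono (prod_mono (Icc_subset_Icc le_rfl (by linarith)) Icc_subset_Ici_self)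
  have step1u := lsw_comparison_step1_upper hκ hcont1 hderθ hderθθ hdert hpde hdir hbd hc₁0.le
    hc₁A hc₁B
  have step1l := lsw_comparison_step1_lower hκ hcont1 hderθ hderθθ hdert hpde hbd hg₁ hg₂
    hc₂0.le hc₂m₁ hc₂m₂
  -- Step 2: the inequalities at `t = 1` on all of `[0, 2π]`
  have step2u : ∀ θ ∈ Icc 0 (2 * π), g θ 1 ≤ c₁ * lswH κ θ 1 := by
    intro θ hθ
    rcases le_or_gt θ π with hθπ | hθπ
    · have := step1u θ ⟨hθ.1, hθπ⟩; nlinarith [sq_nonneg θ]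
    · have hg := (hbd θ hθ 1 zero_le_one).2
      have hH : c₁ * A ≤ c₁ * lswH κ θ 1 :=
        mul_le_mul_of_nonneg_left (lswH_ge hκ hπ.le hθπ.le hθ.2 le_rfl) hc₁0.le
      nlinarith [sq_nonneg π]
  have step2l : ∀ θ ∈ Icc 0 (2 * π), lswH κ θ 1 ≤ c₂ * g θ 1 := by
    intro θ hθ
    rcases le_or_gt θ π with hθπ | hθπ
    · have := step1l θ ⟨hθ.1, hθπ⟩; nlinarith [sq_nonneg θ]
    · have hH1 : lswH κ θ 1 ≤ 1 := lswH_le_one hκ hθ.1 hθ.2 zero_le_one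
      have hgm : c₂ * m₃ ≤ c₂ * g θ 1 := mul_le_mul_of_nonneg_left (hg₃ θ ⟨hθπ.le, hθ.2⟩) hc₂0.le
      linarith
  -- Step 3 on `[0, 2π] × [1, ∞)`
  have hcont3 : ContinuousOn (fun p : ℝ × ℝ => g p.1 p.2) (Icc 0 (2 * π) ×ˢ Ici 1) :=
    hcont.mono (prod_mono le_rfl (Ici_subset_Ici.2 zero_le_one))
  have step3 := lsw_comparison_step3 hκ hcont3 hderθ hderθθ hdert hpde hdir hneu step2u step2l
  refine ⟨1 / c₂, c₁, by positivity, hc₁0, fun t ht θ hθ => ?_⟩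
  have := step3 t ht θ hθ
  constructor
  · rw [div_mul_eq_mul_div, one_mul, div_le_iff₀ hc₂0]
    linarith [this.2]
  · exact this.1

end Comparison

end Literature.Probability.Percolation
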